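import Summits.QuantumFields.YangMills.Theorems.SwapVirialDeficitGnomonicTaylorHubLine
import HarnessLib

/-!
# W4, part K7e: JETS ALONG B-LINES — the `x₀`-direction normalised by the TRANSVERSE base `√(1+u₁²+u₂²)` (the `|u|`-uniform cubic datum of the B-tubes)
# (free-hands support of ⟨stmt-QuantumFields-24197⟩ `SwapVirialDeficit.SwapGluedStiffness`; cell ym-idea-1, ➎ plan of record memo7 §E(3); w2 g59's K7e request
# 2026-08-31 20:1xZ, written by w2 in fcl-p3 g47's K-series letters — g47's ✓K7d verbatim except for ONE size estimate)

On the stratum-B tubes the base is the transverse letter `u = (x₁, x₂)` and the fibre contains the axial letter `x₀`; as `|u| → ∞` (the equator of the leader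
sphere) the gnomonic chart degenerates and the `x₀`-letter must be rescaled, `x₀ = √(1+|u|²)·x₀′` (w3 g66 19:57Z ∕ LEAD g99 20:01Z).  K7d's size of the `x`-direction
is the PLAIN `√Σ(ξ.1.1)ₖ²` (foot norm `≥ 1`, ✓`one_le_norm_foot`), which after rescaling is `√(1+|u|²)|x₀′|` — not uniform.  But along a B-line the `x`-letter moves
as `(x₀⁰ + sξ₀, u₁, u₂)`: the foot of the perpendicular of this line has `re = 1`, `imJ = u₁`, `imK = u₂`, hence norm `≥ √(1+u₁²+u₂²)`, and ✓`jet4_radialUnit_line`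
gives the `x`-leader a 4-jet of size `|ξ₀|∕√(1+|u|²) = |x₀′|`.  Everything else is K7d verbatim:
* §1 `sqrt_le_norm_foot_B`, ★ `jet4_gnoLetterLine_B (ε) (v ξ) (h1 : ξ 1 = 0) (h2 : ξ 2 = 0)` (size `√Σξᵢ²∕√(1 + (v 1² + v 2²))`);
* §2 ★★ `jet4_leader_hubLine_B` (every leader: size `2|δ₁|∕‖im a‖ + √Σ(ξ.1.1)²∕√(1+(η.1.1 1² + η.1.1 2²)) + √Σ(ξ.1.2)² + √Σ(ξ.2.1)²`);
* §3 ★★ `realJet4_gnoDeficit_hubLine_B_le`, ★★★ `taylor_four_gnoDeficit_hubLine_B` — for `ψ(s) = F̂_{a − (sδ₁)·1, ε}(η + sξ)` with `ξ.1.1 1 = ξ.1.1 2 = 0`,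
  `|δ₁| ≤ S‖im a‖`, `√Σ(ξ.1.1)² ≤ S·√(1+(η.1.1 1² + η.1.1 2²))` and the other letter sizes `≤ S`: `|ψ′| ≤ 1008L⁴S`, `|ψ″| ≤ 39984L⁴S²`, `|ψ‴| ≤ 6816096L⁴S³`,
  `|ψ⁗| ≤ 1464571584L⁴S⁴` everywhere, and the two Taylor remainders at `s = 0` (SAME constants as K7d).

HONEST LABEL: calculus plumbing (no measure); nothing about ⟨24197⟩ ∕ ⟨24194⟩ (OPEN) is proved; own crux ⟨22884⟩ OPEN (blocked-on ⟨19935⟩); the Yang–Mills mass gap is NOT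
proved; no summit is proved by a line.  THEOREMS ONLY (0 `def`, 0 `sorry`), standard axioms, no local instances.  Width seat ym-line-sfw-p2-w2 g59 (cell ym-idea-1, free hands),
`--supports stmt-QuantumFields-24197`.  References: [cite: Luscher1983, §2]; [folklore].
-/

set_option autoImplicit false

noncomputable section

open Quaternion Set
open scoped Quaternion RealInnerProductSpace BigOperators
open Literature.MathematicalPhysics.QuantumLattice
open Literature.MathematicalPhysics.QuantumFieldTheory hiding SU2
open Literature.Analysis.Calculus (radialUnit radialUnit_def norm_radialUnit)
open Summit.QuantumFields.YangMills.Theorems.FemtoTransferGap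
open Summit.QuantumFields.YangMills.Theorems.FemtoTransferGap.TT
open Summit.QuantumFields.YangMills.Theorems.SwapTwistDeficit.ToronLog (axisPoint)
open Summit.QuantumFields.YangMills.Theorems.SwapVirialDeficit.ZeroModeSigma (su2Quat_quatToSU2_eq_radialUnit slaveP norm_axisUnit dil3 dil3_apply)
open Summit.QuantumFields.YangMills.Theorems.SwapVirialDeficit.BlowUp (leaderTuple dil3_one' dilateIm_one_apply qDeficit swapRingDeficit_eq_qDeficit)
open Summit.QuantumFields.YangMills.Theorems.SwapVirialDeficit.BlowUpRing

namespace Summit.QuantumFields.YangMills.Theorems.SwapVirialDeficit.Gnomonic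

variable {L : ℕ} [NeZero L]

/-! ## §1 A gnomonic letter along a B-line: the foot keeps the transverse base -/

omit [NeZero L] in
/-- ★ The foot of the perpendicular of a B-line `s ↦ (1, v + sξ)` with `ξ = (ξ₀, 0, 0)` keeps `re = 1`, `imJ = v 1`, `imK = v 2`, hence has norm `≥ √(1 + (v 1² + v 2²))`
(for ANY axial start `v 0`). [folklore] -/
theorem sqrt_le_norm_foot_B (v ξ : Fin 3 → ℝ) (h1 : ξ 1 = 0) (h2 : ξ 2 = 0) :
    Real.sqrt (1 + (v 1 ^ 2 + v 2 ^ 2)) ≤ ‖gnomonicQuat v + (-(⟪gnomonicQuat v, gnomonicQuat ξ - 1⟫ / ‖gnomonicQuat ξ - 1‖ ^ 2)) • (gnomonicQuat ξ - 1)‖ := by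
  set c : ℝ := -(⟪gnomonicQuat v, gnomonicQuat ξ - 1⟫ / ‖gnomonicQuat ξ - 1‖ ^ 2) with hc
  have hre : (gnomonicQuat v + c • (gnomonicQuat ξ - 1)).re = 1 := by simp [gnomonicQuat]
  have hJ : (gnomonicQuat v + c • (gnomonicQuat ξ - 1)).imJ = v 1 := by simp [gnomonicQuat, h1]
  have hK : (gnomonicQuat v + c • (gnomonicQuat ξ - 1)).imK = v 2 := by simp [gnomonicQuat, h2]
  have hsq : 1 + (v 1 ^ 2 + v 2 ^ 2) ≤ ‖gnomonicQuat v + c • (gnomonicQuat ξ - 1)‖ ^ 2 := by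
    have e : ‖gnomonicQuat v + c • (gnomonicQuat ξ - 1)‖ ^ 2 = Quaternion.normSq (gnomonicQuat v + c • (gnomonicQuat ξ - 1)) := by
      rw [Quaternion.normSq_eq_norm_mul_self, sq]
    rw [e, Quaternion.normSq_def', hre, hJ, hK]
    nlinarith [sq_nonneg (gnomonicQuat v + c • (gnomonicQuat ξ - 1)).imI]
  calc Real.sqrt (1 + (v 1 ^ 2 + v 2 ^ 2)) ≤ Real.sqrt (‖gnomonicQuat v + c • (gnomonicQuat ξ - 1)‖ ^ 2) := Real.sqrt_le_sqrt hsq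
    _ = ‖gnomonicQuat v + c • (gnomonicQuat ξ - 1)‖ := Real.sqrt_sq (norm_nonneg _)

omit [NeZero L] in
/-- ★★ **A GNOMONIC LETTER ALONG A B-LINE CARRIES A 4-JET OF SIZE `√Σξᵢ²∕√(1 + (v 1² + v 2²))`**: for the axial direction `ξ = (ξ₀, 0, 0)` at a base point with
transverse part `(v 1, v 2)`, `s ↦ su2Quat (quatToSU2 (gnoLetter ε (v + s • ξ)))` has four derivatives with norms `≤ N, N², 3N³, 9N⁴`, `N = |ξ₀|∕√(1+|v_⊥|²)`
(✓`jet4_radialUnit_line` with the foot bound `sqrt_le_norm_foot_B`). [folklore] -/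
theorem jet4_gnoLetterLine_B (ε : Bool) (v ξ : Fin 3 → ℝ) (h1 : ξ 1 = 0) (h2 : ξ 2 = 0) :
    ∃ f₁ f₂ f₃ f₄ : ℝ → ℍ, (∀ s, HasDerivAt (fun s : ℝ => su2Quat (quatToSU2 (gnoLetter ε (v + s • ξ)))) (f₁ s) s) ∧ (∀ s, HasDerivAt f₁ (f₂ s) s) ∧
      (∀ s, HasDerivAt f₂ (f₃ s) s) ∧ (∀ s, HasDerivAt f₃ (f₄ s) s) ∧
      ∀ s, ‖su2Quat (quatToSU2 (gnoLetter ε (v + s • ξ)))‖ ≤ 1 ∧ ‖f₁ s‖ ≤ Real.sqrt (∑ i, ξ i ^ 2) / Real.sqrt (1 + (v 1 ^ 2 + v 2 ^ 2)) ∧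
        ‖f₂ s‖ ≤ (Real.sqrt (∑ i, ξ i ^ 2) / Real.sqrt (1 + (v 1 ^ 2 + v 2 ^ 2))) ^ 2 ∧
        ‖f₃ s‖ ≤ 3 * (Real.sqrt (∑ i, ξ i ^ 2) / Real.sqrt (1 + (v 1 ^ 2 + v 2 ^ 2))) ^ 3 ∧
        ‖f₄ s‖ ≤ 9 * (Real.sqrt (∑ i, ξ i ^ 2) / Real.sqrt (1 + (v 1 ^ 2 + v 2 ^ 2))) ^ 4 := by
  set w : ℍ := gnomonicQuat ξ - 1 with hwdef
  set u₀' : ℍ := gnomonicQuat v + (-(⟪gnomonicQuat v, w⟫ / ‖w‖ ^ 2)) • w with hu₀'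
  have hfoot : u₀' ≠ 0 := foot_ne_zero v ξ
  have h := jet4_smul (abs_gnoSign ε) (jet4_radialUnit_line (u₀ := gnomonicQuat v) (w := w) hfoot)
  -- the size `‖w‖/‖u₀′‖ ≤ ‖w‖/√(1+|v_⊥|²)`
  have hw : ‖w‖ = Real.sqrt (∑ i, ξ i ^ 2) := by rw [← norm_gnomonicQuat_sub_one ξ, norm_one, div_one]
  have hN : 0 < Real.sqrt (1 + (v 1 ^ 2 + v 2 ^ 2)) := Real.sqrt_pos.2 (by positivity)
  have hsize : ‖w‖ / ‖u₀'‖ ≤ Real.sqrt (∑ i, ξ i ^ 2) / Real.sqrt (1 + (v 1 ^ 2 + v 2 ^ 2)) := by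
    rw [← hw]
    exact div_le_div_of_nonneg_left (norm_nonneg _) hN (sqrt_le_norm_foot_B v ξ h1 h2)
  have h' := jet4_mono (by positivity) hsize h
  have e : ∀ s : ℝ, gnoSign ε • radialUnit (gnomonicQuat v + s • w) = su2Quat (quatToSU2 (gnoLetter ε (v + s • ξ))) := fun s => by
    rw [gnoLetter_eq, su2Quat_quatToSU2_smul_gnomonicQuat (abs_gnoSign ε), gnomonicQuat_add_smul]
  simpa only [e] using h'

/-! ## §2 Leaders along the joint hub–letter B-line -/

omit [NeZero L] in
/-- ★★ **LEADER JETS ALONG A JOINT HUB–LETTER B-LINE**: for `im a ≠ 0` and an axial `x`-direction (`ξ.1.1 1 = ξ.1.1 2 = 0`), every leader of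
`blowUpPoint 1 (gnomonicPoint (a − (sδ₁)·1) ε (η + s • ξ))` carries a 4-jet of size `2|δ₁|∕‖im a‖ + √Σ(ξ.1.1)²∕√(1+(η.1.1 1² + η.1.1 2²)) + √Σ(ξ.1.2)² + √Σ(ξ.2.1)²`
(K7d ✓`jet4_leader_hubLine` with `jet4_gnoLetterLine_B` on the `x`-letter). [folklore] -/
theorem jet4_leader_hubLine_B {a : ℍ} (ha : a.im ≠ 0) (δ₁ : ℝ) (ε : BlowUpRing.GnoSign L) (η ξ : BlowUpRing.GnoCoord L) (h1 : ξ.1.1 1 = 0) (h2 : ξ.1.1 2 = 0)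
    (μ : Fin 4) :
    ∃ f₁ f₂ f₃ f₄ : ℝ → ℍ,
      (∀ s, HasDerivAt (fun s : ℝ => su2Quat ((BlowUpRing.blowUpPoint (L := L) 1 (BlowUpRing.gnomonicPoint (a - (s * δ₁) • (1 : ℍ)) ε (η + s • ξ))).1 μ)) (f₁ s) s) ∧
      (∀ s, HasDerivAt f₁ (f₂ s) s) ∧ (∀ s, HasDerivAt f₂ (f₃ s) s) ∧ (∀ s, HasDerivAt f₃ (f₄ s) s) ∧
      ∀ s, ‖su2Quat ((BlowUpRing.blowUpPoint (L := L) 1 (BlowUpRing.gnomonicPoint (a - (s * δ₁) • (1 : ℍ)) ε (η + s • ξ))).1 μ)‖ ≤ 1 ∧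
        ‖f₁ s‖ ≤ 2 * (|δ₁| / ‖a.im‖) + Real.sqrt (∑ k, ξ.1.1 k ^ 2) / Real.sqrt (1 + (η.1.1 1 ^ 2 + η.1.1 2 ^ 2)) + Real.sqrt (∑ k, ξ.1.2 k ^ 2) +
          Real.sqrt (∑ k, ξ.2.1 k ^ 2) ∧
        ‖f₂ s‖ ≤ (2 * (|δ₁| / ‖a.im‖) + Real.sqrt (∑ k, ξ.1.1 k ^ 2) / Real.sqrt (1 + (η.1.1 1 ^ 2 + η.1.1 2 ^ 2)) + Real.sqrt (∑ k, ξ.1.2 k ^ 2) +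
          Real.sqrt (∑ k, ξ.2.1 k ^ 2)) ^ 2 ∧
        ‖f₃ s‖ ≤ 3 * (2 * (|δ₁| / ‖a.im‖) + Real.sqrt (∑ k, ξ.1.1 k ^ 2) / Real.sqrt (1 + (η.1.1 1 ^ 2 + η.1.1 2 ^ 2)) + Real.sqrt (∑ k, ξ.1.2 k ^ 2) +
          Real.sqrt (∑ k, ξ.2.1 k ^ 2)) ^ 3 ∧
        ‖f₄ s‖ ≤ 9 * (2 * (|δ₁| / ‖a.im‖) + Real.sqrt (∑ k, ξ.1.1 k ^ 2) / Real.sqrt (1 + (η.1.1 1 ^ 2 + η.1.1 2 ^ 2)) + Real.sqrt (∑ k, ξ.1.2 k ^ 2) +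
          Real.sqrt (∑ k, ξ.2.1 k ^ 2)) ^ 4 := by
  have hH : 0 ≤ |δ₁| / ‖a.im‖ := by positivity
  have hx : 0 ≤ Real.sqrt (∑ k, ξ.1.1 k ^ 2) / Real.sqrt (1 + (η.1.1 1 ^ 2 + η.1.1 2 ^ 2)) := by positivity
  have hy : 0 ≤ Real.sqrt (∑ k, ξ.1.2 k ^ 2) := Real.sqrt_nonneg _
  have hz : 0 ≤ Real.sqrt (∑ k, ξ.2.1 k ^ 2) := Real.sqrt_nonneg _
  have ha0 : ∀ s : ℝ, a - (s * δ₁) • (1 : ℍ) ≠ 0 := fun s => sub_smul_one_ne_zero ha _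
  match μ with
  | ⟨0, _⟩ =>
    have e : ∀ s : ℝ, su2Quat (quatToSU2 (gnoLetter ε.1.1 (η.1.1 + s • ξ.1.1))) =
        su2Quat ((BlowUpRing.blowUpPoint (L := L) 1 (BlowUpRing.gnomonicPoint (a - (s * δ₁) • (1 : ℍ)) ε (η + s • ξ))).1 ⟨0, by omega⟩) := fun s => by
      show _ = su2Quat (leaderTuple (a - (s * δ₁) • (1 : ℍ)) (dil3 1 (BlowUpRing.gnomonicPoint (a - (s * δ₁) • (1 : ℍ)) ε (η + s • ξ)).2.1) 0)
      rw [(BlowUp.leaderTuple_apply _ _).1, dil3_one']; rfl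
    have h := jet4_mono hx (show _ ≤ 2 * (|δ₁| / ‖a.im‖) + Real.sqrt (∑ k, ξ.1.1 k ^ 2) / Real.sqrt (1 + (η.1.1 1 ^ 2 + η.1.1 2 ^ 2)) +
        Real.sqrt (∑ k, ξ.1.2 k ^ 2) + Real.sqrt (∑ k, ξ.2.1 k ^ 2) by linarith) (jet4_gnoLetterLine_B ε.1.1 η.1.1 ξ.1.1 h1 h2)
    simpa only [e] using h
  | ⟨1, _⟩ =>
    -- the slaved letter `Ā(s)·x̂(s)·A(s)·ẑ(s)` with the MOVING hub unit `A(s)`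
    have hA := jet4_hubAxis_line ha δ₁
    have h3 := jet4_mul (by positivity) hz
      (jet4_mul (by positivity) hH (jet4_mul hH hx (jet4_star hA) (jet4_gnoLetterLine_B ε.1.1 η.1.1 ξ.1.1 h1 h2)) hA)
      (jet4_gnoLetterLine ε.2.1 η.2.1 ξ.2.1)
    have e : ∀ s : ℝ, star (radialUnit (axisPoint (a - (s * δ₁) • (1 : ℍ)))) * su2Quat (quatToSU2 (gnoLetter ε.1.1 (η.1.1 + s • ξ.1.1))) *
        radialUnit (axisPoint (a - (s * δ₁) • (1 : ℍ))) * su2Quat (quatToSU2 (gnoLetter ε.2.1 (η.2.1 + s • ξ.2.1))) =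
        su2Quat ((BlowUpRing.blowUpPoint (L := L) 1 (BlowUpRing.gnomonicPoint (a - (s * δ₁) • (1 : ℍ)) ε (η + s • ξ))).1 ⟨1, by omega⟩) := fun s => by
      rw [← su2Quat_quatToSU2_slaveP_mul (norm_axisUnit (ha0 s)) (gnoLetter_ne_zero _ _) (gnoLetter_ne_zero _ _)]
      show _ = su2Quat (leaderTuple (a - (s * δ₁) • (1 : ℍ)) (dil3 1 (BlowUpRing.gnomonicPoint (a - (s * δ₁) • (1 : ℍ)) ε (η + s • ξ)).2.1) 1)
      rw [(BlowUp.leaderTuple_apply _ _).2.1, dil3_one']; rfl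
    have h := jet4_mono (by positivity) (show |δ₁| / ‖a.im‖ + Real.sqrt (∑ k, ξ.1.1 k ^ 2) / Real.sqrt (1 + (η.1.1 1 ^ 2 + η.1.1 2 ^ 2)) + |δ₁| / ‖a.im‖ +
        Real.sqrt (∑ k, ξ.2.1 k ^ 2) ≤
        2 * (|δ₁| / ‖a.im‖) + Real.sqrt (∑ k, ξ.1.1 k ^ 2) / Real.sqrt (1 + (η.1.1 1 ^ 2 + η.1.1 2 ^ 2)) + Real.sqrt (∑ k, ξ.1.2 k ^ 2) +
          Real.sqrt (∑ k, ξ.2.1 k ^ 2) by linarith) h3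
    simpa only [e] using h
  | ⟨2, _⟩ =>
    have e : ∀ s : ℝ, su2Quat (quatToSU2 (gnoLetter ε.1.2 (η.1.2 + s • ξ.1.2))) =
        su2Quat ((BlowUpRing.blowUpPoint (L := L) 1 (BlowUpRing.gnomonicPoint (a - (s * δ₁) • (1 : ℍ)) ε (η + s • ξ))).1 ⟨2, by omega⟩) := fun s => by
      show _ = su2Quat (leaderTuple (a - (s * δ₁) • (1 : ℍ)) (dil3 1 (BlowUpRing.gnomonicPoint (a - (s * δ₁) • (1 : ℍ)) ε (η + s • ξ)).2.1) 2)
      rw [(BlowUp.leaderTuple_apply _ _).2.2.1, dil3_one']; rfl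
    have h := jet4_mono hy (show _ ≤ 2 * (|δ₁| / ‖a.im‖) + Real.sqrt (∑ k, ξ.1.1 k ^ 2) / Real.sqrt (1 + (η.1.1 1 ^ 2 + η.1.1 2 ^ 2)) +
        Real.sqrt (∑ k, ξ.1.2 k ^ 2) + Real.sqrt (∑ k, ξ.2.1 k ^ 2) by linarith) (jet4_gnoLetterLine ε.1.2 η.1.2 ξ.1.2)
    simpa only [e] using h
  | ⟨3, _⟩ =>
    have e : ∀ s : ℝ, radialUnit (axisPoint (a - (s * δ₁) • (1 : ℍ))) =
        su2Quat ((BlowUpRing.blowUpPoint (L := L) 1 (BlowUpRing.gnomonicPoint (a - (s * δ₁) • (1 : ℍ)) ε (η + s • ξ))).1 ⟨3, by omega⟩) := fun s => by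
      show _ = su2Quat (leaderTuple (a - (s * δ₁) • (1 : ℍ)) (dil3 1 (BlowUpRing.gnomonicPoint (a - (s * δ₁) • (1 : ℍ)) ε (η + s • ξ)).2.1) 3)
      rw [(BlowUp.leaderTuple_apply _ _).2.2.2]; exact (su2Quat_quatToSU2_axisUnit (ha0 s)).symm
    have h := jet4_mono hH (show |δ₁| / ‖a.im‖ ≤ 2 * (|δ₁| / ‖a.im‖) + Real.sqrt (∑ k, ξ.1.1 k ^ 2) / Real.sqrt (1 + (η.1.1 1 ^ 2 + η.1.1 2 ^ 2)) +
        Real.sqrt (∑ k, ξ.1.2 k ^ 2) + Real.sqrt (∑ k, ξ.2.1 k ^ 2) by linarith) (jet4_hubAxis_line ha δ₁)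
    simpa only [e] using h

/-! ## §3 The joint 4-jet of the deficit along B-lines and its Taylor data -/

set_option maxHeartbeats 400000 in
/-- ★★ **FOUR DERIVATIVE WITNESSES OF `s ↦ F̂_{a − (sδ₁)·1, ε}(η + s·ξ)` ALONG A B-LINE** (`ξ.1.1 1 = ξ.1.1 2 = 0`), bounded by `1008L⁴S`, `39984L⁴S²`, `6816096L⁴S³`,
`1464571584L⁴S⁴` when `|δ₁| ≤ S·‖im a‖`, `√Σ(ξ.1.1)² ≤ S·√(1+(η.1.1 1² + η.1.1 2²))` and the other letter sizes are `≤ S` (K7d with `jet4_leader_hubLine_B`). [cite: Luscher1983, §2] -/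
theorem realJet4_gnoDeficit_hubLine_B_le (z : Fin 3 → Bool) (χ : Site 3 L → SU2) {a : ℍ} (ha : a.im ≠ 0) (δ₁ : ℝ) (ε : GnoSign L) (η ξ : GnoCoord L)
    (h1 : ξ.1.1 1 = 0) (h2 : ξ.1.1 2 = 0) {S : ℝ} (hS : 0 ≤ S) (hδ : |δ₁| ≤ S * ‖a.im‖)
    (hx : Real.sqrt (∑ k, ξ.1.1 k ^ 2) ≤ S * Real.sqrt (1 + (η.1.1 1 ^ 2 + η.1.1 2 ^ 2))) (hy : Real.sqrt (∑ k, ξ.1.2 k ^ 2) ≤ S)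
    (hz : Real.sqrt (∑ k, ξ.2.1 k ^ 2) ≤ S) (hf : ∀ i, Real.sqrt (∑ k, ξ.2.2 i k ^ 2) ≤ S) :
    ∃ d₁ d₂ d₃ d₄ : ℝ → ℝ, (∀ s, HasDerivAt (fun s : ℝ => gnoDeficit z χ (a - (s * δ₁) • (1 : ℍ)) ε (η + s • ξ)) (d₁ s) s) ∧
      (∀ s, HasDerivAt d₁ (d₂ s) s) ∧ (∀ s, HasDerivAt d₂ (d₃ s) s) ∧ (∀ s, HasDerivAt d₃ (d₄ s) s) ∧
      ∀ s, |d₁ s| ≤ 1008 * (L : ℝ) ^ 4 * S ∧ |d₂ s| ≤ 39984 * (L : ℝ) ^ 4 * S ^ 2 ∧ |d₃ s| ≤ 6816096 * (L : ℝ) ^ 4 * S ^ 3 ∧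
        |d₄ s| ≤ 1464571584 * (L : ℝ) ^ 4 * S ^ 4 := by
  have hn : 0 < ‖a.im‖ := norm_pos_iff.2 ha
  have hH : |δ₁| / ‖a.im‖ ≤ S := by rw [div_le_iff₀ hn]; exact hδ
  have hN : 0 < Real.sqrt (1 + (η.1.1 1 ^ 2 + η.1.1 2 ^ 2)) := Real.sqrt_pos.2 (by positivity)
  have hx' : Real.sqrt (∑ k, ξ.1.1 k ^ 2) / Real.sqrt (1 + (η.1.1 1 ^ 2 + η.1.1 2 ^ 2)) ≤ S := by rw [div_le_iff₀ hN]; exact hx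
  -- the letters: leaders `≤ 5S`, followers `≤ S`
  have hC : ∀ μ : Fin 4, ∃ f₁ f₂ f₃ f₄ : ℝ → ℍ,
      (∀ s, HasDerivAt (fun s : ℝ => su2Quat ((blowUpPoint (L := L) 1 (gnomonicPoint (a - (s * δ₁) • (1 : ℍ)) ε (η + s • ξ))).1 μ)) (f₁ s) s) ∧
      (∀ s, HasDerivAt f₁ (f₂ s) s) ∧ (∀ s, HasDerivAt f₂ (f₃ s) s) ∧ (∀ s, HasDerivAt f₃ (f₄ s) s) ∧
      ∀ s, ‖su2Quat ((blowUpPoint (L := L) 1 (gnomonicPoint (a - (s * δ₁) • (1 : ℍ)) ε (η + s • ξ))).1 μ)‖ ≤ 1 ∧ ‖f₁ s‖ ≤ 5 * S ∧ ‖f₂ s‖ ≤ (5 * S) ^ 2 ∧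
        ‖f₃ s‖ ≤ 3 * (5 * S) ^ 3 ∧ ‖f₄ s‖ ≤ 9 * (5 * S) ^ 4 :=
    fun μ => jet4_mono (by positivity) (by linarith) (jet4_leader_hubLine_B ha δ₁ ε η ξ h1 h2 μ)
  have hU : ∀ i : Fol L, ∃ f₁ f₂ f₃ f₄ : ℝ → ℍ,
      (∀ s, HasDerivAt (fun s : ℝ => su2Quat ((blowUpPoint (L := L) 1 (gnomonicPoint (a - (s * δ₁) • (1 : ℍ)) ε (η + s • ξ))).2 i)) (f₁ s) s) ∧
      (∀ s, HasDerivAt f₁ (f₂ s) s) ∧ (∀ s, HasDerivAt f₂ (f₃ s) s) ∧ (∀ s, HasDerivAt f₃ (f₄ s) s) ∧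
      ∀ s, ‖su2Quat ((blowUpPoint (L := L) 1 (gnomonicPoint (a - (s * δ₁) • (1 : ℍ)) ε (η + s • ξ))).2 i)‖ ≤ 1 ∧ ‖f₁ s‖ ≤ S ∧ ‖f₂ s‖ ≤ S ^ 2 ∧
        ‖f₃ s‖ ≤ 3 * S ^ 3 ∧ ‖f₄ s‖ ≤ 9 * S ^ 4 :=
    fun i => jet4_mono (Real.sqrt_nonneg _) (hf i) (jet4_follower_hubLine a δ₁ ε η ξ i)
  -- the words and the deficit
  obtain ⟨hl, hs⟩ := jet4_fixHistory (C := fun s => (blowUpPoint (L := L) 1 (gnomonicPoint (a - (s * δ₁) • (1 : ℍ)) ε (η + s • ξ))).1)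
    (U := fun s => (blowUpPoint (L := L) 1 (gnomonicPoint (a - (s * δ₁) • (1 : ℍ)) ε (η + s • ξ))).2) χ (by positivity : (0 : ℝ) ≤ 5 * S) hS hC hU
  have e7 : 5 * S + S + S = 7 * S := by ring
  rw [e7] at hl hs
  have h := realJet4_qDeficit_le (L := L) z (M := 7 * S) (by positivity)
    (Q := fun s => ((fun (i : Fin (2 * L - 1 + 1)) (e : Edge 3 L) =>
        su2Quat ((fixHistory (ringConfig χ (blowUpPoint (L := L) 1 (gnomonicPoint (a - (s * δ₁) • (1 : ℍ)) ε (η + s • ξ))))).1 i e)),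
      fun x : Site 3 L => su2Quat ((fixHistory (ringConfig χ (blowUpPoint (L := L) 1 (gnomonicPoint (a - (s * δ₁) • (1 : ℍ)) ε (η + s • ξ))))).2 x)))
    (fun i e => hl i e) (fun x => hs x)
  have e : (fun s : ℝ => gnoDeficit z χ (a - (s * δ₁) • (1 : ℍ)) ε (η + s • ξ)) = fun s => qDeficit z
      ((fun (i : Fin (2 * L - 1 + 1)) (e : Edge 3 L) =>
          su2Quat ((fixHistory (ringConfig χ (blowUpPoint (L := L) 1 (gnomonicPoint (a - (s * δ₁) • (1 : ℍ)) ε (η + s • ξ))))).1 i e)),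
        fun x : Site 3 L => su2Quat ((fixHistory (ringConfig χ (blowUpPoint (L := L) 1 (gnomonicPoint (a - (s * δ₁) • (1 : ℍ)) ε (η + s • ξ))))).2 x)) :=
    funext fun s => swapRingDeficit_eq_qDeficit z _
  rw [e]
  refine realJet4_mono ?_ ?_ ?_ ?_ h
  · nlinarith [pow_nonneg (Nat.cast_nonneg L : (0 : ℝ) ≤ L) 4]
  · nlinarith [pow_nonneg (Nat.cast_nonneg L : (0 : ℝ) ≤ L) 4, sq_nonneg S]
  · nlinarith [pow_nonneg (Nat.cast_nonneg L : (0 : ℝ) ≤ L) 4, pow_nonneg hS 3]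
  · nlinarith [pow_nonneg (Nat.cast_nonneg L : (0 : ℝ) ≤ L) 4, pow_nonneg hS 4]

/-- ★★★ **THE σ-GLUED DEFICIT IS `C⁴`-BOUNDED ALONG B-LINES WITH THE TRANSVERSALLY NORMALISED `x₀`-SIZE** (the `|u|`-uniform Taylor data of the B-tube fibres):
for `im a ≠ 0`, signs `ε`, base point `η`, direction `ξ` with `ξ.1.1 1 = ξ.1.1 2 = 0`, `√Σ(ξ.1.1)² ≤ S·√(1+(η.1.1 1² + η.1.1 2²))`, the other letter sizes `≤ S`, hub speed
`|δ₁| ≤ S·‖im a‖`, and `ψ s = gnoDeficit z χ (a − (sδ₁)·1) ε (η + s • ξ)`: `|ψ′| ≤ 1008L⁴S`, `|ψ″| ≤ 39984L⁴S²`, `|ψ‴| ≤ 6816096L⁴S³`, `|ψ⁗| ≤ 1464571584L⁴S⁴`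
EVERYWHERE, and at `s = 0` `|ψ 1 − ψ 0 − ψ′ 0 − ψ″ 0∕2| ≤ 6816096L⁴S³∕2`, `|ψ 1 − ψ 0 − ψ′ 0 − ψ″ 0∕2 − ψ‴ 0∕6| ≤ 1464571584L⁴S⁴∕6`. [cite: Luscher1983, §2] -/
theorem taylor_four_gnoDeficit_hubLine_B (z : Fin 3 → Bool) (χ : Site 3 L → SU2) {a : ℍ} (ha : a.im ≠ 0) (δ₁ : ℝ) (ε : GnoSign L) (η ξ : GnoCoord L)
    (h1 : ξ.1.1 1 = 0) (h2 : ξ.1.1 2 = 0) {S : ℝ} (hS : 0 ≤ S) (hδ : |δ₁| ≤ S * ‖a.im‖)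
    (hx : Real.sqrt (∑ k, ξ.1.1 k ^ 2) ≤ S * Real.sqrt (1 + (η.1.1 1 ^ 2 + η.1.1 2 ^ 2))) (hy : Real.sqrt (∑ k, ξ.1.2 k ^ 2) ≤ S)
    (hz : Real.sqrt (∑ k, ξ.2.1 k ^ 2) ≤ S) (hf : ∀ i, Real.sqrt (∑ k, ξ.2.2 i k ^ 2) ≤ S) :
    (∀ s, |deriv (fun s : ℝ => gnoDeficit z χ (a - (s * δ₁) • (1 : ℍ)) ε (η + s • ξ)) s| ≤ 1008 * (L : ℝ) ^ 4 * S ∧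
        |iteratedDeriv 2 (fun s : ℝ => gnoDeficit z χ (a - (s * δ₁) • (1 : ℍ)) ε (η + s • ξ)) s| ≤ 39984 * (L : ℝ) ^ 4 * S ^ 2 ∧
        |iteratedDeriv 3 (fun s : ℝ => gnoDeficit z χ (a - (s * δ₁) • (1 : ℍ)) ε (η + s • ξ)) s| ≤ 6816096 * (L : ℝ) ^ 4 * S ^ 3 ∧
        |iteratedDeriv 4 (fun s : ℝ => gnoDeficit z χ (a - (s * δ₁) • (1 : ℍ)) ε (η + s • ξ)) s| ≤ 1464571584 * (L : ℝ) ^ 4 * S ^ 4) ∧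
      |gnoDeficit z χ (a - δ₁ • (1 : ℍ)) ε (η + ξ) - gnoDeficit z χ a ε η - deriv (fun s : ℝ => gnoDeficit z χ (a - (s * δ₁) • (1 : ℍ)) ε (η + s • ξ)) 0 -
          iteratedDeriv 2 (fun s : ℝ => gnoDeficit z χ (a - (s * δ₁) • (1 : ℍ)) ε (η + s • ξ)) 0 / 2| ≤ 6816096 * (L : ℝ) ^ 4 * S ^ 3 / 2 ∧
      |gnoDeficit z χ (a - δ₁ • (1 : ℍ)) ε (η + ξ) - gnoDeficit z χ a ε η - deriv (fun s : ℝ => gnoDeficit z χ (a - (s * δ₁) • (1 : ℍ)) ε (η + s • ξ)) 0 -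
          iteratedDeriv 2 (fun s : ℝ => gnoDeficit z χ (a - (s * δ₁) • (1 : ℍ)) ε (η + s • ξ)) 0 / 2 -
          iteratedDeriv 3 (fun s : ℝ => gnoDeficit z χ (a - (s * δ₁) • (1 : ℍ)) ε (η + s • ξ)) 0 / 6| ≤ 1464571584 * (L : ℝ) ^ 4 * S ^ 4 / 6 := by
  obtain ⟨d₁, d₂, d₃, d₄, h₁, h₂, h₃, h₄, hb⟩ := realJet4_gnoDeficit_hubLine_B_le z χ ha δ₁ ε η ξ h1 h2 hS hδ hx hy hz hf
  obtain ⟨e1, e2, e3, e4⟩ := iteratedDeriv_eq_of_hasDerivAt_chain h₁ h₂ h₃ h₄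
  have e1' : gnoDeficit z χ (a - δ₁ • (1 : ℍ)) ε (η + ξ) = (fun s : ℝ => gnoDeficit z χ (a - (s * δ₁) • (1 : ℍ)) ε (η + s • ξ)) 1 := by
    simp only [one_smul, one_mul]
  have e0' : gnoDeficit z χ a ε η = (fun s : ℝ => gnoDeficit z χ (a - (s * δ₁) • (1 : ℍ)) ε (η + s • ξ)) 0 := by
    simp only [zero_smul, add_zero, zero_mul, sub_zero]
  refine ⟨fun s => ?_, ?_, ?_⟩
  · rw [e1, e2, e3, e4]; exact hb s
  · rw [e1, e2, e1', e0']
    exact abs_taylor_three_remainder_le h₁ h₂ h₃ (fun s _ => (hb s).2.2.1)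
  · rw [e1, e2, e3, e1', e0']
    exact abs_taylor_four_remainder_le h₁ h₂ h₃ h₄ (fun s _ => (hb s).2.2.2)

end Summit.QuantumFields.YangMills.Theorems.SwapVirialDeficit.Gnomonic

end
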